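import Mathlib.Analysis.Calculus.LineDeriv.IntegrationByParts
import Mathlib.MeasureTheory.Function.LpSpace.Complete
import Mathlib.Analysis.Calculus.BumpFunction.Normed
import Literature.Analysis.FunctionSpaces.SobolevDomain
import HarnessLib

/-!
# Discharged fact: the bridge `W^{k,2}(E) = H^k(E)` (`SobolevDomain`)

`Literature.Analysis.FunctionSpaces.SobolevDomain` records, as the named fact
`Literature.Analysis.FunctionSpaces.memSobolevDomain_univ_iff_memSobolev` (`def … : Prop`), the identification of the
weak-derivative Sobolev space `W^{k,2}` on the whole space with the Bessel-potential space `H^k`: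
for an `L²` function `f` on a finite-dimensional real inner product space `E` with values in a
complex Hilbert space `F`, `f ∈ W^{k,2}` on all of `E` (iterated weak derivatives,
`Literature.MemSobolevDomain k 2 ⊤ volume f`) iff the tempered distribution of `f` lies in Mathlib's
Bessel-potential class `TemperedDistribution.MemSobolev k 2` (Evans, *PDE*, §5.8.4, Theorem 8;
Folland, *Introduction to PDE*, §6.A, Theorems (6.1) and (6.3)). This file proves it:

* `Literature.memSobolevDomain_univ_iff_memSobolev_holds : memSobolevDomain_univ_iff_memSobolev`,

so that users holding `(h : memSobolevDomain_univ_iff_memSobolev)` can discharge the hypothesis.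
The companion file `SobolevDomainProofs` (weak derivatives of `C¹` functions, uniqueness,
Rellich–Kondrachov) is independent of this one.

## Proof

Folland (*Introduction to PDE*, 2nd ed., §6.A, p. 191) defines
`H_k = {f ∈ L² : ∂^α f ∈ L² (distribution derivatives) for |α| ≤ k}` and proves
(Theorem (6.1)) `f ∈ H_k ⇔ (1 + |ξ|²)^{k/2} f̂ ∈ L²` and, for real `s` and `f ∈ 𝓢'`
(Theorem (6.3)), `f ∈ H_s ⇔ ∂^α f ∈ H_{s-k}` for `|α| ≤ k`. We follow this architecture with
`k = 1` steps, by induction on `k`: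

* *Fourier side* (`Literature.Analysis.FunctionSpaces.memSobolev_add_one_iff`, Folland (6.3) with `k = 1`): for a tempered
  distribution `u` and real `s`, `u ∈ H^{s+1} ⇔ u ∈ H^s ∧ ∀ v, ∂_v u ∈ H^s`. (⇒) is Mathlib's
  `MemSobolev.mono`/`MemSobolev.lineDerivOp`; (⇐) uses `J² = 1 - (2π)⁻² Δ` (`J^s` the Bessel
  potential, `Literature.Analysis.FunctionSpaces.besselPotential_two_eq`) and `Δ = Σᵢ ∂ᵢ∂ᵢ` along an orthonormal basis, so
  `J² u ∈ H^{s-1}`, i.e. `u ∈ H^{s+1}`.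
* *Weak = distributional derivative for `L²` data* (`Literature.Analysis.FunctionSpaces.lineDerivOp_toTemperedDistribution_eq_iff`
  and the three `integral_fderiv_smul_eq_neg_*` lemmas): for `f, g ∈ L²`, `∂_v f = g` in `𝓢'` iff
  `∫ (∂_v φ) f = -∫ φ g` for all Schwartz `φ`, iff the same holds for all complex, resp. real,
  `C_c^∞` test functions. Schwartz ⇒ `C_c^∞` is the inclusion `C_c^∞ ⊆ 𝓢`; `C_c^∞` ⇒ Schwartz
  truncates `φ` by smooth cutoffs `χₙ = χ(·/(n+1))` (`Literature.Analysis.FunctionSpaces.exists_smooth_cutoff_seq`) and passes to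
  the limit by dominated convergence (the products of `L²` functions are integrable).
* *Assembly* (`Literature.Analysis.FunctionSpaces.memSobolevDomain_univ_iff_memSobolev_holds`): induction on `k`; at `k = 0`
  both sides say `f ∈ L²`; at `k + 1`, the components `x ↦ Df(x) v` of a weak Fréchet derivative
  are the distributional derivatives `∂_v f`, and conversely the `L²` representatives `Gᵢ` of
  `∂_{eᵢ} f` along an orthonormal basis `(eᵢ)` assemble to the weak Fréchet derivative
  `Df(x) v = Σᵢ ⟪eᵢ, v⟫ Gᵢ(x)`.

(Implementation note: `E →L[ℝ] F`-valued integrability facts are obtained only as outputs of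
Mathlib lemmas (`ContinuousLinearMap.comp_memLp'`, `memLp_finsetSum`), never restated, because
restating them makes the elaborator compare the operator-norm topology instance path with
`ContinuousLinearMap.topologicalSpace` inside `MemLp`, which times out.)

## References

* L. C. Evans, *Partial Differential Equations*, 2nd ed. (2010), §5.2.1 (weak derivatives);
  §5.8.4, Theorem 8 (characterization of `H^k` by the Fourier transform).
* G. B. Folland, *Introduction to Partial Differential Equations*, 2nd ed. (1995), §6.A,
  Theorems (6.1), (6.3), pp. 191–192.
* R. Adams, J. Fournier, *Sobolev Spaces*, 2nd ed. (2003), ¶7.62–7.63 (`W^{s,2} = L^{s,2}`).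
-/

noncomputable section

open MeasureTheory ENNReal Set Filter Function Metric TopologicalSpace TemperedDistribution
  FourierTransform
open scoped SchwartzMap LineDeriv Laplacian Real NNReal ContDiff Topology InnerProductSpace

namespace Literature.Analysis.FunctionSpaces

section Cutoff

variable {E : Type*} [NormedAddCommGroup E] [InnerProductSpace ℝ E] [FiniteDimensional ℝ E]

/-- **Smooth cutoffs.** On a finite-dimensional real inner product space there is a sequence of
smooth compactly supported functions `χₙ(x) = χ(x/(n+1))` (`χ` a fixed bump function equal to `1`
on the unit ball) with values in `[0, 1]`, uniformly bounded derivatives `‖Dχₙ(x)‖ ≤ C`, and such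
that every point has a neighbourhood on which `χₙ = 1` for all large `n` (the standard truncation
device behind the density of `C_c^∞` in the Sobolev spaces, Folland, *Introduction to PDE*, §6.A,
p. 192: "`𝓢` (or even `C_c^∞`) is dense"). [folklore] -/
theorem exists_smooth_cutoff_seq :
    ∃ (χ : ℕ → E → ℝ) (C : ℝ), (∀ n, ContDiff ℝ ∞ (χ n)) ∧ (∀ n, HasCompactSupport (χ n)) ∧
      (∀ n x, ‖χ n x‖ ≤ 1) ∧ (∀ n x, ‖fderiv ℝ (χ n) x‖ ≤ C) ∧
      (∀ x : E, ∀ᶠ n in atTop, χ n =ᶠ[𝓝 x] fun _ => 1) := by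
  let χ₀ : ContDiffBump (0 : E) := ⟨1, 2, one_pos, one_lt_two⟩
  obtain ⟨C, hC⟩ :=
    ((χ₀.contDiff (n := 1)).continuous_fderiv one_ne_zero).bounded_above_of_compact_support
      (χ₀.hasCompactSupport.fderiv (𝕜 := ℝ))
  have hC0 : 0 ≤ C := (norm_nonneg _).trans (hC 0)
  set c : ℕ → ℝ := fun n => ((n : ℝ) + 1)⁻¹ with hc_def
  have hc_pos : ∀ n, 0 < c n := fun n => by positivity
  have hc_le : ∀ n, c n ≤ 1 := fun n => by
    simp only [hc_def]
    exact inv_le_one_of_one_le₀ (by linarith [n.cast_nonneg (α := ℝ)])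
  refine ⟨fun n x => χ₀ (c n • x), C, fun n => ?_, fun n => ?_, fun n x => ?_, fun n x => ?_,
    fun x => ?_⟩
  · exact χ₀.contDiff.comp (contDiff_const_smul _)
  · refine HasCompactSupport.intro (isCompact_closedBall (0 : E) (2 * (c n)⁻¹)) fun x hx => ?_
    apply χ₀.zero_of_le_dist
    simp only [Metric.mem_closedBall, dist_zero_right, not_le] at hx
    rw [dist_zero_right, norm_smul, Real.norm_of_nonneg (hc_pos n).le]
    have := mul_lt_mul_of_pos_left hx (hc_pos n)
    rw [← mul_assoc, mul_comm (c n) 2, mul_assoc, mul_inv_cancel₀ (hc_pos n).ne', mul_one] at this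
    exact this.le
  · rw [Real.norm_of_nonneg χ₀.nonneg]
    exact χ₀.le_one
  · have h : HasFDerivAt (fun x => χ₀ (c n • x))
        ((fderiv ℝ χ₀ (c n • x)).comp (c n • ContinuousLinearMap.id ℝ E)) x :=
      ((χ₀.contDiff (n := 1)).differentiable (by simp) _).hasFDerivAt.comp x
        ((hasFDerivAt_id x).const_smul (c n))
    rw [h.fderiv]
    refine (ContinuousLinearMap.opNorm_comp_le _ _).trans ?_
    refine (mul_le_mul (hC _) le_rfl (norm_nonneg _) hC0).trans ?_
    rw [norm_smul, Real.norm_of_nonneg (hc_pos n).le]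
    calc C * (c n * ‖ContinuousLinearMap.id ℝ E‖) ≤ C * (1 * 1) := by
          gcongr
          · exact hc_le n
          · exact ContinuousLinearMap.norm_id_le
      _ = C := by ring
  · obtain ⟨N, hN⟩ := exists_nat_gt ‖x‖
    refine eventually_atTop.2 ⟨N, fun n hn => ?_⟩
    have hmem : c n • x ∈ Metric.ball (0 : E) χ₀.rIn := by
      rw [Metric.mem_ball, dist_zero_right, norm_smul, Real.norm_of_nonneg (hc_pos n).le,
        show χ₀.rIn = 1 from rfl, hc_def, inv_mul_lt_iff₀ (by positivity), mul_one]
      calc ‖x‖ < N := hN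
        _ ≤ n := by exact_mod_cast hn
        _ ≤ (n : ℝ) + 1 := by linarith
    have h1 : χ₀ =ᶠ[𝓝 (c n • x)] 1 := χ₀.eventuallyEq_one_of_mem_ball hmem
    exact ((continuous_const_smul (c n)).continuousAt (x := x)).eventually h1

end Cutoff

section WeakVsDistributional

/-! #### Weak versus distributional derivatives of `L²` functions -/

variable {E : Type*} [NormedAddCommGroup E] [InnerProductSpace ℝ E] [FiniteDimensional ℝ E]
  [MeasurableSpace E] [BorelSpace E]
variable {F : Type*} [NormedAddCommGroup F] [NormedSpace ℂ F]

/-- The product of two `L²` functions (scalar times vector) is integrable: Hölder's inequality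
with exponents `2, 2` (Cauchy–Schwarz), Mathlib's `MemLp.smul`. [folklore] -/
theorem integrable_smul_of_memLp_two {u : E → ℂ} {w : E → F} (hu : MemLp u 2 volume)
    (hw : MemLp w 2 volume) : Integrable (fun x => u x • w x) := by
  have : MemLp (u • w) 1 volume := hw.smul hu
  exact memLp_one_iff_integrable.1 this

omit [NormedSpace ℂ F] in
/-- The product of the norms of two `L²` functions is integrable (Cauchy–Schwarz). [folklore] -/
theorem integrable_norm_mul_norm_of_memLp_two {G : Type*} [NormedAddCommGroup G] {u : E → G}
    {w : E → F} (hu : MemLp u 2 volume) (hw : MemLp w 2 volume) :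
    Integrable (fun x => ‖u x‖ * ‖w x‖) := by
  have : MemLp (fun x => ‖u x‖ * ‖w x‖) 1 volume := hw.norm.mul' hu.norm
  exact memLp_one_iff_integrable.1 this

/-- **From `C_c^∞` to Schwartz test functions.** If `f, g ∈ L²(E; F)` satisfy the
integration-by-parts identity `∫ (∂_v ψ) f = -∫ ψ g` for all smooth compactly supported complex
test functions `ψ`, then the identity holds for all Schwartz functions `φ`: truncate `φ` by the
smooth cutoffs `χₙ` of `exists_smooth_cutoff_seq`, note `∂_v(χₙ φ) = χₙ ∂_v φ + (∂_v χₙ) φ` with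
`|χₙ| ≤ 1`, `‖Dχₙ‖ ≤ C`, and pass to the limit `n → ∞` by dominated convergence (dominating
function `(‖∂_v φ‖ + C‖v‖‖φ‖)‖f‖ + ‖φ‖‖g‖ ∈ L¹` by Cauchy–Schwarz). This is the standard density
step behind "distribution derivatives in `L²`" in Folland, *Introduction to PDE*, §6.A, p. 191
(definition of `H_k`). [folklore] -/
theorem integral_fderiv_smul_eq_neg_schwartz_of_hasCompactSupport {f g : E → F}
    (hf : MemLp f 2 volume) (hg : MemLp g 2 volume) (v : E)
    (H : ∀ ψ : E → ℂ, ContDiff ℝ ∞ ψ → HasCompactSupport ψ →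
      ∫ x, (fderiv ℝ ψ x v) • f x = -∫ x, ψ x • g x)
    (φ : 𝓢(E, ℂ)) : ∫ x, (fderiv ℝ φ x v) • f x = -∫ x, φ x • g x := by
  obtain ⟨χ, C, hχ_smooth, hχ_supp, hχ_le, hχ_fderiv, hχ_lim⟩ := exists_smooth_cutoff_seq (E := E)
  have hC0 : 0 ≤ C := (norm_nonneg _).trans (hχ_fderiv 0 0)
  -- truncated test functions `ψ n = χ n • φ`
  set ψ : ℕ → E → ℂ := fun n x => χ n x • φ x with hψ_def
  have hψ_smooth : ∀ n, ContDiff ℝ ∞ (ψ n) := fun n => (hχ_smooth n).smul (φ.smooth ⊤)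
  have hψ_supp : ∀ n, HasCompactSupport (ψ n) := fun n =>
    (hχ_supp n).smul_right (f' := (φ : E → ℂ))
  have hψ_fderiv : ∀ n x, fderiv ℝ (ψ n) x v =
      χ n x • fderiv ℝ φ x v + (fderiv ℝ (χ n) x v) • φ x := by
    intro n x
    have h1 : HasFDerivAt (χ n) (fderiv ℝ (χ n) x) x :=
      ((hχ_smooth n).differentiable (by simp) x).hasFDerivAt
    have h2 : HasFDerivAt (φ : E → ℂ) (fderiv ℝ φ x) x := φ.hasFDerivAt x
    rw [show ψ n = fun y => χ n y • φ y from rfl, (h1.fun_smul h2).fderiv]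
    simp
  -- integrability of the compactly supported integrands
  have hf_loc : LocallyIntegrable f volume := hf.locallyIntegrable (by norm_num)
  have hg_loc : LocallyIntegrable g volume := hg.locallyIntegrable (by norm_num)
  have hA : ∀ n, Integrable (fun x => (fderiv ℝ (ψ n) x v) • f x) := fun n =>
    hf_loc.integrable_smul_left_of_hasCompactSupport
      (((hψ_smooth n).continuous_fderiv (by simp)).clm_apply continuous_const)
      ((hψ_supp n).fderiv_apply (𝕜 := ℝ) v)
  have hB : ∀ n, Integrable (fun x => ψ n x • g x) := fun n =>
    hg_loc.integrable_smul_left_of_hasCompactSupport (hψ_smooth n).continuous (hψ_supp n)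
  -- the combined integrands `Φ n`, with `∫ Φ n = 0`
  set Φ : ℕ → E → F := fun n x => (fderiv ℝ (ψ n) x v) • f x + ψ n x • g x with hΦ_def
  have hΦ_zero : ∀ n, ∫ x, Φ n x = 0 := by
    intro n
    simp only [hΦ_def]
    rw [integral_add (hA n) (hB n), H (ψ n) (hψ_smooth n) (hψ_supp n), neg_add_cancel]
  -- Schwartz × L² integrability
  have hφv : (fun x => fderiv ℝ φ x v) = ⇑(∂_{v} φ : 𝓢(E, ℂ)) := by
    ext x; rw [SchwartzMap.lineDerivOp_apply_eq_fderiv]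
  have hφ2 : MemLp (φ : E → ℂ) 2 volume := φ.memLp 2
  have hφv2 : MemLp (fun x => fderiv ℝ φ x v) 2 volume := by rw [hφv]; exact (∂_{v} φ).memLp 2
  have hI1 : Integrable (fun x => (fderiv ℝ φ x v) • f x) := integrable_smul_of_memLp_two hφv2 hf
  have hI2 : Integrable (fun x => φ x • g x) := integrable_smul_of_memLp_two hφ2 hg
  -- dominated convergence
  have hlim : Tendsto (fun n => ∫ x, Φ n x) atTop
      (𝓝 (∫ x, ((fderiv ℝ φ x v) • f x + φ x • g x))) := by
    refine tendsto_integral_of_dominated_convergence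
      (fun x => (‖fderiv ℝ φ x v‖ + C * ‖v‖ * ‖φ x‖) * ‖f x‖ + ‖φ x‖ * ‖g x‖)
      (fun n => ((hA n).aestronglyMeasurable.add (hB n).aestronglyMeasurable)) ?_ ?_ ?_
    · refine Integrable.add ?_ (integrable_norm_mul_norm_of_memLp_two hφ2 hg)
      have h3 : MemLp (fun x => ‖fderiv ℝ φ x v‖ + C * ‖v‖ * ‖φ x‖) 2 volume :=
        hφv2.norm.add (hφ2.norm.const_mul (C * ‖v‖))
      have := integrable_norm_mul_norm_of_memLp_two h3 hf
      refine this.congr (Eventually.of_forall fun x => ?_)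
      simp only [Real.norm_eq_abs]
      rw [abs_of_nonneg (by positivity)]
    · intro n
      refine Eventually.of_forall fun x => ?_
      simp only [hΦ_def, hψ_fderiv]
      have h1 : ‖χ n x • fderiv ℝ φ x v + (fderiv ℝ (χ n) x v) • φ x‖ ≤
          ‖fderiv ℝ φ x v‖ + C * ‖v‖ * ‖φ x‖ := by
        refine (norm_add_le _ _).trans (add_le_add ?_ ?_)
        · rw [norm_smul]
          exact mul_le_of_le_one_left (norm_nonneg _) (hχ_le n x)
        · rw [norm_smul]
          gcongr
          exact (ContinuousLinearMap.le_opNorm _ _).trans (by gcongr; exact hχ_fderiv n x)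
      have h2 : ‖ψ n x‖ ≤ ‖φ x‖ := by
        simp only [hψ_def, norm_smul]
        exact mul_le_of_le_one_left (norm_nonneg _) (hχ_le n x)
      calc _ ≤ ‖(χ n x • fderiv ℝ φ x v + (fderiv ℝ (χ n) x v) • φ x) • f x‖ + ‖ψ n x • g x‖ :=
            norm_add_le _ _
        _ ≤ (‖fderiv ℝ φ x v‖ + C * ‖v‖ * ‖φ x‖) * ‖f x‖ + ‖φ x‖ * ‖g x‖ := by
            rw [norm_smul, norm_smul]
            gcongr
    · refine Eventually.of_forall fun x => ?_
      have hev : ∀ᶠ n in atTop, Φ n x = (fderiv ℝ φ x v) • f x + φ x • g x := by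
        filter_upwards [hχ_lim x] with n hn
        have hψn : ψ n =ᶠ[𝓝 x] (φ : E → ℂ) := by
          filter_upwards [hn] with y hy
          simp [hψ_def, hy]
        simp only [hΦ_def]
        rw [hψn.fderiv_eq, hψn.eq_of_nhds]
      exact tendsto_const_nhds.congr' (hev.mono fun n hn => hn.symm)
  have hzero : ∫ x, ((fderiv ℝ φ x v) • f x + φ x • g x) = 0 := by
    refine tendsto_nhds_unique hlim ?_
    simp only [hΦ_zero]
    exact tendsto_const_nhds
  rw [integral_add hI1 hI2] at hzero
  exact eq_neg_of_add_eq_zero_left hzero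

/-- **From real to complex `C_c^∞` test functions.** If `f, g` are locally integrable and
`∫ (∂_v φ) f = -∫ φ g` for all *real* smooth compactly supported `φ`, then the same identity holds
for all *complex* smooth compactly supported `ψ` (split `ψ = Re ψ + i Im ψ` and use linearity of
the Bochner integral). [folklore] -/
theorem integral_fderiv_smul_eq_neg_complex_of_real {f g : E → F}
    (hf : LocallyIntegrable f volume) (hg : LocallyIntegrable g volume) (v : E)
    (H : ∀ φ : E → ℝ, ContDiff ℝ ∞ φ → HasCompactSupport φ →
      ∫ x, (fderiv ℝ φ x v) • f x = -∫ x, φ x • g x)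
    (ψ : E → ℂ) (hψ : ContDiff ℝ ∞ ψ) (hψs : HasCompactSupport ψ) :
    ∫ x, (fderiv ℝ ψ x v) • f x = -∫ x, ψ x • g x := by
  -- real and imaginary parts
  set ψr : E → ℝ := fun x => (ψ x).re with hψr_def
  set ψi : E → ℝ := fun x => (ψ x).im with hψi_def
  have hψr : ContDiff ℝ ∞ ψr := Complex.reCLM.contDiff.comp hψ
  have hψi : ContDiff ℝ ∞ ψi := Complex.imCLM.contDiff.comp hψ
  have hψrs : HasCompactSupport ψr := hψs.comp_left (g := Complex.re) rfl
  have hψis : HasCompactSupport ψi := hψs.comp_left (g := Complex.im) rfl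
  have key : ∀ (z : ℂ) (w : F), z • w = z.re • w + Complex.I • (z.im • w) := by
    intro z w
    conv_lhs => rw [← Complex.re_add_im z]
    rw [add_smul, ← Complex.coe_smul, ← Complex.coe_smul, smul_comm Complex.I, smul_smul]
  have hfd : ∀ x,
      fderiv ℝ ψr x v = (fderiv ℝ ψ x v).re ∧ fderiv ℝ ψi x v = (fderiv ℝ ψ x v).im := by
    intro x
    have hd : HasFDerivAt ψ (fderiv ℝ ψ x) x := (hψ.differentiable (by simp) x).hasFDerivAt
    exact ⟨by rw [show ψr = ⇑Complex.reCLM ∘ ψ from rfl,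
        (Complex.reCLM.hasFDerivAt.comp x hd).fderiv]; rfl,
      by rw [show ψi = ⇑Complex.imCLM ∘ ψ from rfl,
        (Complex.imCLM.hasFDerivAt.comp x hd).fderiv]; rfl⟩
  have hAr : Integrable (fun x => (fderiv ℝ ψr x v) • f x) :=
    hf.integrable_smul_left_of_hasCompactSupport
      ((hψr.continuous_fderiv (by simp)).clm_apply continuous_const) (hψrs.fderiv_apply (𝕜 := ℝ) v)
  have hAi : Integrable (fun x => (fderiv ℝ ψi x v) • f x) :=
    hf.integrable_smul_left_of_hasCompactSupport
      ((hψi.continuous_fderiv (by simp)).clm_apply continuous_const) (hψis.fderiv_apply (𝕜 := ℝ) v)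
  have hBr : Integrable (fun x => ψr x • g x) :=
    hg.integrable_smul_left_of_hasCompactSupport hψr.continuous hψrs
  have hBi : Integrable (fun x => ψi x • g x) :=
    hg.integrable_smul_left_of_hasCompactSupport hψi.continuous hψis
  have hAi' : Integrable (fun x => Complex.I • ((fderiv ℝ ψi x v) • f x)) := hAi.smul Complex.I
  have hBi' : Integrable (fun x => Complex.I • (ψi x • g x)) := hBi.smul Complex.I
  calc ∫ x, (fderiv ℝ ψ x v) • f x
      = ∫ x, ((fderiv ℝ ψr x v) • f x + Complex.I • ((fderiv ℝ ψi x v) • f x)) := by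
        congr 1 with x
        rw [key, (hfd x).1, (hfd x).2]
    _ = (∫ x, (fderiv ℝ ψr x v) • f x) + Complex.I • ∫ x, (fderiv ℝ ψi x v) • f x := by
        rw [integral_add hAr hAi', integral_smul]
    _ = -((∫ x, ψr x • g x) + Complex.I • ∫ x, ψi x • g x) := by
        rw [H ψr hψr hψrs, H ψi hψi hψis, smul_neg, neg_add]
    _ = -∫ x, ψ x • g x := by
        rw [← integral_smul, ← integral_add hBr hBi']
        congr 2 with x
        rw [key (ψ x)]

/-- **From Schwartz to real `C_c^∞` test functions.** If `∫ (∂_v φ) f = -∫ φ g` for all complex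
Schwartz functions `φ`, then it holds for all real smooth compactly supported `φ`, since such a
`φ` (viewed as complex-valued) is a Schwartz function (Mathlib's `HasCompactSupport.toSchwartzMap`).
[folklore] -/
theorem integral_fderiv_smul_eq_neg_real_of_schwartz {f g : E → F} (v : E)
    (H : ∀ φ : 𝓢(E, ℂ), ∫ x, (fderiv ℝ φ x v) • f x = -∫ x, φ x • g x)
    (φ : E → ℝ) (hφ : ContDiff ℝ ∞ φ) (hφs : HasCompactSupport φ) :
    ∫ x, (fderiv ℝ φ x v) • f x = -∫ x, φ x • g x := by
  have h1 : HasCompactSupport (fun x => (φ x : ℂ)) := hφs.comp_left (g := Complex.ofReal) rfl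
  have h2 : ContDiff ℝ ∞ (fun x => (φ x : ℂ)) := Complex.ofRealCLM.contDiff.comp hφ
  have h3 := H (h1.toSchwartzMap h2)
  have h4 : ∀ x, fderiv ℝ (h1.toSchwartzMap h2) x v = ((fderiv ℝ φ x v : ℝ) : ℂ) := by
    intro x
    have hd : HasFDerivAt φ (fderiv ℝ φ x) x := (hφ.differentiable (by simp) x).hasFDerivAt
    rw [show ⇑(h1.toSchwartzMap h2) = ⇑Complex.ofRealCLM ∘ φ from rfl,
      (Complex.ofRealCLM.hasFDerivAt.comp x hd).fderiv]
    rfl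
  have h5 : ∀ x, (h1.toSchwartzMap h2) x = (φ x : ℂ) := fun x => rfl
  simp only [h4, h5, Complex.coe_smul] at h3
  exact h3

variable [CompleteSpace F]

/-- The tempered distribution of an `L²` function `f`, evaluated at a Schwartz function `φ`, is
`∫ φ • f` (Mathlib's `Lp.toTemperedDistribution_apply`, transported along the a.e. equality
`hf.toLp f = f`). [folklore] -/
theorem toTemperedDistribution_toLp_apply {f : E → F} (hf : MemLp f 2 volume) (φ : 𝓢(E, ℂ)) :
    (Lp.toTemperedDistribution (hf.toLp f) : 𝓢'(E, F)) φ = ∫ x, φ x • f x := by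
  rw [Lp.toTemperedDistribution_apply]
  refine integral_congr_ae ?_
  filter_upwards [hf.coeFn_toLp] with x hx
  rw [hx]

/-- **Distributional derivative of an `L²` function.** For `f, g ∈ L²(E; F)` and a direction
`v`, the distributional derivative `∂_v f` (Mathlib's `LineDeriv` structure on `𝓢'(E, F)`,
`⟨∂_v f, φ⟩ = -⟨f, ∂_v φ⟩`) equals (the distribution of) `g` iff the integration-by-parts identity
`∫ (∂_v φ) f = -∫ φ g` holds for every Schwartz function `φ` — the meaning of "distribution
derivative `∂^α f ∈ L²`" in Folland, *Introduction to PDE*, §6.A, p. 191. [folklore] -/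
theorem lineDerivOp_toTemperedDistribution_eq_iff {f g : E → F} (hf : MemLp f 2 volume)
    (hg : MemLp g 2 volume) (v : E) :
    ∂_{v} (Lp.toTemperedDistribution (hf.toLp f) : 𝓢'(E, F)) =
        Lp.toTemperedDistribution (hg.toLp g) ↔
      ∀ φ : 𝓢(E, ℂ), ∫ x, (fderiv ℝ φ x v) • f x = -∫ x, φ x • g x := by
  have key : ∀ φ : 𝓢(E, ℂ), (∂_{v} (Lp.toTemperedDistribution (hf.toLp f) : 𝓢'(E, F))) φ =
      -∫ x, (fderiv ℝ φ x v) • f x := by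
    intro φ
    rw [TemperedDistribution.lineDerivOp_apply_apply, toTemperedDistribution_toLp_apply,
      ← integral_neg]
    congr 1 with x
    rw [neg_apply, SchwartzMap.lineDerivOp_apply_eq_fderiv, neg_smul]
  constructor
  · intro h φ
    have := congrArg (fun T : 𝓢'(E, F) => T φ) h
    simp only [key, toTemperedDistribution_toLp_apply] at this
    rw [← this, neg_neg]
  · intro h
    ext φ
    rw [key, toTemperedDistribution_toLp_apply, h φ, neg_neg]

end WeakVsDistributional

section FourierSide

/-! #### The Fourier side: `H^{s+1} = {u ∈ H^s : ∂u ∈ H^s}` -/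

variable {E : Type*} [NormedAddCommGroup E] [InnerProductSpace ℝ E] [FiniteDimensional ℝ E]
  [MeasurableSpace E] [BorelSpace E]
variable {F : Type*} [NormedAddCommGroup F]

section normed

variable [NormedSpace ℂ F]

/-- Additivity of Mathlib's Fourier multiplier operator on `𝓢'` in the symbol, for symbols of
temperate growth (from `TemperedDistribution.smulLeftCLM_add`). [folklore] -/
theorem fourierMultiplierCLM_add {g₁ g₂ : E → ℂ} (hg₁ : g₁.HasTemperateGrowth)
    (hg₂ : g₂.HasTemperateGrowth) :
    fourierMultiplierCLM F (g₁ + g₂) = fourierMultiplierCLM F g₁ + fourierMultiplierCLM F g₂ := by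
  ext1 f
  simp [fourierMultiplierCLM_apply, smulLeftCLM_add hg₁ hg₂]

/-- `J² = 1 - (2π)⁻² Δ` on tempered distributions, where `J^s` is Mathlib's Bessel potential
`TemperedDistribution.besselPotential E F s` (symbol `(1 + ‖ξ‖²)^{s/2}`) and `Δ` the
distributional Laplacian (symbol `-(2π)²‖ξ‖²`,
`TemperedDistribution.laplacian_eq_fourierMultiplierCLM`); cf. the docstring of
`TemperedDistribution.besselPotential` ("the operator `(1 - (2π)^{-2} Δ)^{s/2}`"). [folklore] -/
theorem besselPotential_two_eq (f : 𝓢'(E, F)) :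
    besselPotential E F 2 f = f - ((2 * π) ^ 2)⁻¹ • Δ f := by
  have h1 : (fun x : E ↦ (((1 + ‖x‖ ^ 2) ^ ((2 : ℝ) / 2) : ℝ) : ℂ)) =
      (fun _ : E ↦ (1 : ℂ)) + fun x : E ↦ ((‖x‖ ^ 2 : ℝ) : ℂ) := by
    ext x
    simp
  rw [besselPotential, h1, fourierMultiplierCLM_add (by fun_prop) (by fun_prop),
    add_apply, fourierMultiplierCLM_const, laplacian_eq_fourierMultiplierCLM,
    smul_smul, mul_neg, inv_mul_cancel₀ (by positivity), neg_one_smul, sub_neg_eq_add]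
  simp

variable [CompleteSpace F]

/-- Finite sums of `H^{s,p}` distributions are in `H^{s,p}` (from Mathlib's `MemSobolev.add`).
[folklore] -/
theorem memSobolev_finsetSum {ι : Type*} {s : ℝ} {p : ℝ≥0∞} [Fact (1 ≤ p)] (S : Finset ι)
    {f : ι → 𝓢'(E, F)} (hf : ∀ i ∈ S, MemSobolev s p (f i)) :
    MemSobolev s p (∑ i ∈ S, f i) := by
  classical
  induction S using Finset.induction_on with
  | empty => simp
  | insert a S ha ih =>
    rw [Finset.sum_insert ha]
    exact (hf a (Finset.mem_insert_self a S)).add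
      (ih fun i hi => hf i (Finset.mem_insert_of_mem hi))

end normed

variable [InnerProductSpace ℂ F] [CompleteSpace F]

/-- **`H^{s+1} = {u ∈ H^s : ∂_v u ∈ H^s for all v}`** (Folland, *Introduction to PDE*, §6.A,
Theorem (6.3), p. 192, the case `k = 1`: "`f ∈ H_s` if and only if `∂^α f ∈ H_{s-k}` for
`|α| ≤ k`", here for Mathlib's Bessel-potential classes `MemSobolev s 2` of distributions with
values in a complex Hilbert space). (⇒): `H^{s+1} ⊆ H^s` and `∂_v : H^{s+1} → H^s` (Mathlib's
`MemSobolev.mono`, `MemSobolev.lineDerivOp`). (⇐): `J² u = u - (2π)⁻² Δ u` with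
`Δ u = Σᵢ ∂_{eᵢ} ∂_{eᵢ} u ∈ H^{s-1}`, so `J² u ∈ H^{s-1}`, i.e. `u ∈ H^{s+1}`.
[cite: Folland1995PDE, §6.A Theorem (6.3), p. 192] -/
theorem memSobolev_add_one_iff {s : ℝ} {f : 𝓢'(E, F)} :
    MemSobolev (s + 1) 2 f ↔ MemSobolev s 2 f ∧ ∀ v : E, MemSobolev s 2 (∂_{v} f) := by
  constructor
  · intro hf
    refine ⟨hf.mono (by linarith), fun v => ?_⟩
    simpa using hf.lineDerivOp (m := v)
  · rintro ⟨hf, hf'⟩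
    -- `J² f = f - (2π)⁻² Δ f ∈ H^{s-1}`, hence `f ∈ H^{s+1}`.
    have hΔ : MemSobolev (s - 1) 2 (Δ f) := by
      rw [laplacian_eq_sum (stdOrthonormalBasis ℝ E)]
      exact memSobolev_finsetSum _ fun i _ => (hf' _).lineDerivOp
    have h2 : MemSobolev (s - 1) 2 (besselPotential E F 2 f) := by
      rw [besselPotential_two_eq]
      exact (hf.mono (by linarith)).sub (hΔ.smul _)
    have := memSobolev_besselPotential_iff.mp h2
    convert this using 1
    ring

end FourierSide

section Bridge

/-! #### Assembly -/

/-- `W^{k+1,p}(Ω) ⊆ W^{k,p}(Ω)` (Evans, *PDE*, §5.2.2, immediate from the Definition; here by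
recursion on `k` along the recursive definition of `Literature.Analysis.FunctionSpaces.MemSobolevDomain`). [folklore] -/
theorem MemSobolevDomain.of_succ {E' : Type*} [NormedAddCommGroup E'] [NormedSpace ℝ E']
    [MeasurableSpace E'] {F' : Type*} [NormedAddCommGroup F'] [NormedSpace ℝ F'] :
    ∀ {k : ℕ} {p : ℝ≥0∞} {Ω : Opens E'} {μ : Measure E'} {f : E' → F'},
      MemSobolevDomain (k + 1) p Ω μ f → MemSobolevDomain k p Ω μ f
  | 0, _, _, _, _, h => h.1
  | _ + 1, _, _, _, _, ⟨h0, g, hg, hgk⟩ => ⟨h0, g, hg, fun v => MemSobolevDomain.of_succ (hgk v)⟩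

variable {E : Type*} [NormedAddCommGroup E] [InnerProductSpace ℝ E] [FiniteDimensional ℝ E]
  [MeasurableSpace E] [BorelSpace E]
variable {F : Type*} [NormedAddCommGroup F] [InnerProductSpace ℂ F] [CompleteSpace F]

/-- **Discharge of `memSobolevDomain_univ_iff_memSobolev`: `W^{k,2}(E) = H^k(E)`.** For
`f ∈ L²(E; F)` (`E` a finite-dimensional real inner product space with its Haar/Lebesgue measure,
`F` a complex Hilbert space) and `k : ℕ`, `f` has iterated weak derivatives up to order `k` in
`L²` on all of `E` (`MemSobolevDomain k 2 ⊤ volume f`) iff its tempered distribution lies in the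
Bessel-potential class `MemSobolev k 2` (`⟨D⟩^k f ∈ L²`). This is Folland, *Introduction to
PDE*, §6.A: `H_k := {f ∈ L² : ∂^α f ∈ L² for |α| ≤ k}` (p. 191) coincides with the Fourier-side
space (Theorem (6.1)), proved here through Theorem (6.3) (`f ∈ H_s ⇔ ∂^α f ∈ H_{s-k}, |α| ≤ k`)
with `k = 1` (`memSobolev_add_one_iff`) and induction on `k`; equivalently Evans, *PDE*, §5.8.4,
Theorem 8 (characterization of `H^k` by the Fourier transform), the citation carried by the
fact. Induction step: (⇒) the components `x ↦ Df(x) v ∈ W^{k,2}` of a weak Fréchet derivative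
`Df` are, as distributions, the derivatives `∂_v f` (the weak identity against real `C_c^∞` test
functions upgrades to complex `C_c^∞` and then to Schwartz test functions,
`integral_fderiv_smul_eq_neg_schwartz_of_hasCompactSupport`), so `f, ∂_v f ∈ H^k` and
`f ∈ H^{k+1}`; (⇐) `f ∈ H^{k+1}` gives `∂_v f ∈ H^k ⊆ L²`; with `Gᵢ ∈ L²` representing
`∂_{eᵢ} f` along an orthonormal basis `(eᵢ)`, `Df(x) v := Σᵢ ⟪eᵢ, v⟫ Gᵢ(x)` is a weak Fréchet
derivative of `f` (linearity of `∂_v φ` in `v`) whose components represent `∂_v f ∈ H^k`, hence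
lie in `W^{k,2}` by induction. [cite: Folland1995PDE, §6.A Theorems (6.1) and (6.3), pp. 191–192] [cite: Evans2010, §5.8.4 Theorem 8] -/
theorem memSobolevDomain_univ_iff_memSobolev_holds :
    memSobolevDomain_univ_iff_memSobolev (E := E) (F := F) := by
  intro k
  induction k with
  | zero =>
    intro f hf
    simp only [memSobolevDomain_zero_iff, Opens.coe_top, Measure.restrict_univ, Nat.cast_zero,
      memSobolev_zero_iff]
    exact ⟨fun _ => ⟨hf.toLp f, rfl⟩, fun _ => hf⟩
  | succ k ih =>
    intro f hf
    rw [memSobolevDomain_succ_iff, Nat.cast_succ, memSobolev_add_one_iff]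
    have hf_loc : LocallyIntegrable f volume := hf.locallyIntegrable (by norm_num)
    -- Schwartz test functions and their derivatives are in `L²`
    have hφv2 : ∀ (φ : 𝓢(E, ℂ)) (v : E), MemLp (fun x => fderiv ℝ φ x v) 2 volume := by
      intro φ v
      have : (fun x => fderiv ℝ φ x v) = ⇑(∂_{v} φ : 𝓢(E, ℂ)) := by
        ext x; rw [SchwartzMap.lineDerivOp_apply_eq_fderiv]
      rw [this]; exact (∂_{v} φ).memLp 2
    constructor
    · rintro ⟨hf0, g, hg, hgk⟩
      refine ⟨(ih f hf).1 (MemSobolevDomain.of_succ ⟨hf0, g, hg, hgk⟩), fun v => ?_⟩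
      have hGk : MemSobolevDomain k 2 ⊤ volume (fun x => g x v) := hgk v
      have hG : MemLp (fun x => g x v) 2 volume := by simpa using hGk.memLp
      have h2 : ∂_{v} (Lp.toTemperedDistribution (hf.toLp f) : 𝓢'(E, F)) =
          Lp.toTemperedDistribution (hG.toLp _) := by
        rw [lineDerivOp_toTemperedDistribution_eq_iff hf hG v]
        intro φ
        refine integral_fderiv_smul_eq_neg_schwartz_of_hasCompactSupport hf hG v ?_ φ
        intro ψ hψ hψs
        refine integral_fderiv_smul_eq_neg_complex_of_real hf_loc
          (hG.locallyIntegrable (by norm_num)) v ?_ ψ hψ hψs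
        intro φ hφ hφs
        simpa using hg.integral_fderiv_smul_eq φ v ⟨hφ, hφs, by simp⟩
      rw [h2]
      exact (ih _ hG).1 hGk
    · rintro ⟨hk, hkv⟩
      set T : 𝓢'(E, F) := Lp.toTemperedDistribution (hf.toLp f)
      set b := stdOrthonormalBasis ℝ E
      have hG0 : ∀ i, ∃ G : Lp F 2 (volume : Measure E), ∂_{b i} T = G := fun i =>
        memSobolev_zero_iff.1 ((hkv (b i)).mono (Nat.cast_nonneg k))
      choose G hG using hG0
      have hGm : ∀ i, MemLp (G i : E → F) 2 volume := fun i => Lp.memLp (G i)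
      -- the weak Fréchet derivative, assembled from the directional ones along the basis
      set L : Fin (Module.finrank ℝ E) → F →L[ℝ] (E →L[ℝ] F) := fun i =>
        ContinuousLinearMap.smulRightL ℝ E F (innerSL ℝ (b i)) with hL
      obtain ⟨g, hg_def⟩ : ∃ g : E → E →L[ℝ] F,
          g = fun a => ∑ i ∈ Finset.univ, (⇑(L i) ∘ (G i : E → F)) a := ⟨_, rfl⟩
      have hg_apply : ∀ x v, g x v = ∑ i, ⟪b i, v⟫_ℝ • (G i : E → F) x := by
        intro x v
        simp [hg_def, hL]
      -- `E →L[ℝ] F`-valued integrability: use the terms produced by Mathlib's lemmas as they are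
      -- (see the implementation note in the module docstring)
      have hLG := fun i => (L i).comp_memLp' (hGm i)
      have hgm := memLp_finsetSum Finset.univ fun i _ => hLG i
      have hg_loc := (hgm.locallyIntegrable (by norm_num)).locallyIntegrableOn Set.univ
      have hgv : ∀ v, MemLp (fun x => g x v) 2 volume := by
        intro v
        simp_rw [hg_apply]
        exact memLp_finsetSum _ fun i _ => (hGm i).const_smul _
      -- Schwartz identity along the basis directions
      have hSi : ∀ i (φ : 𝓢(E, ℂ)),
          ∫ x, (fderiv ℝ φ x (b i)) • f x = -∫ x, φ x • (G i : E → F) x := by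
        intro i
        rw [← lineDerivOp_toTemperedDistribution_eq_iff hf (hGm i) (b i), Lp.toLp_coeFn]
        exact hG i
      -- Schwartz identity in every direction
      have hS : ∀ v (φ : 𝓢(E, ℂ)), ∫ x, (fderiv ℝ φ x v) • f x = -∫ x, φ x • g x v := by
        intro v φ
        have hv : ∀ x, fderiv ℝ φ x v = ∑ i, ⟪b i, v⟫_ℝ • fderiv ℝ φ x (b i) := by
          intro x
          conv_lhs => rw [← b.sum_repr' v]
          simp [map_sum, map_smul]
        have hI1 : ∀ i, Integrable (fun x => (fderiv ℝ φ x (b i)) • f x) := fun i =>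
          integrable_smul_of_memLp_two (hφv2 φ (b i)) hf
        have hI2 : ∀ i, Integrable (fun x => φ x • (G i : E → F) x) := fun i =>
          integrable_smul_of_memLp_two (φ.memLp 2) (hGm i)
        calc ∫ x, (fderiv ℝ φ x v) • f x
            = ∫ x, ∑ i, ⟪b i, v⟫_ℝ • ((fderiv ℝ φ x (b i)) • f x) := by
              congr 1 with x
              rw [hv x, Finset.sum_smul]
              simp only [smul_assoc]
          _ = ∑ i, ⟪b i, v⟫_ℝ • ∫ x, (fderiv ℝ φ x (b i)) • f x := by
              rw [integral_finsetSum _ (f := fun i x => ⟪b i, v⟫_ℝ • ((fderiv ℝ φ x (b i)) • f x))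
                fun i _ => (hI1 i).smul _]
              simp only [integral_smul]
          _ = -∑ i, ⟪b i, v⟫_ℝ • ∫ x, φ x • (G i : E → F) x := by
              simp only [hSi, smul_neg, Finset.sum_neg_distrib]
          _ = -∫ x, ∑ i, ⟪b i, v⟫_ℝ • (φ x • (G i : E → F) x) := by
              rw [integral_finsetSum _ (f := fun i x => ⟪b i, v⟫_ℝ • (φ x • (G i : E → F) x))
                fun i _ => (hI2 i).smul _]
              simp only [integral_smul]
          _ = -∫ x, φ x • g x v := by
              congr 2 with x
              rw [hg_apply, Finset.smul_sum]
              simp only [smul_comm (φ x)]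
      have hC : ∀ v, ∂_{v} T = Lp.toTemperedDistribution ((hgv v).toLp _) := fun v =>
        (lineDerivOp_toTemperedDistribution_eq_iff hf (hgv v) v).2 (hS v)
      refine ⟨by simpa using hf, g, ⟨?_, ?_, ?_⟩, fun v => ?_⟩
      · exact hf_loc.locallyIntegrableOn _
      · rw [hg_def]
        exact hg_loc
      · intro φ v hφ
        simp only [Opens.coe_top, Measure.restrict_univ]
        exact integral_fderiv_smul_eq_neg_real_of_schwartz v (hS v) φ hφ.contDiff
          hφ.hasCompactSupport
      · refine (ih _ (hgv v)).2 ?_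
        rw [← hC v]
        exact hkv v

end Bridge

end Literature.Analysis.FunctionSpaces
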